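import Mathlib
import Summits.Ventures.PercRepro2.FourTypedTable

/-!
# Seven typed edges, 0: short names for the tables (blind cell PercRepro2, night-3, 2026-08-25)

`K7` / `L7` abbreviate the pair / triple tables `lk1` / `lk2''` of the two-typed abstract cube, so that the
`128 × 365` orbit terms of the seven-edge cube tests stay below the gate's file size limit.
-/

namespace Summit.Ventures.PercRepro2

open UnionCluster

namespace CovForm

namespace TwoTyped

open OneTyped

section Tables7

/-- The pair table `lk1`. -/
def K7 (i j : ℕ) : ℕ := lk1 i j

/-- The triple table `lk2''`. -/
def L7 (i j k : ℕ) : ℕ := lk2'' i j k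

end Tables7

end TwoTyped

end CovForm

end Summit.Ventures.PercRepro2
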